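/-
Copyright: statement-level skeleton of a published paper (lit-balaban cell, Phase-2 proof seat p37 gen 106). No claims beyond
what the kernel checks below.
-/
import Literature.MathematicalPhysics.QuantumFieldTheory.Balaban1983to89.B3GraphGlue

/-!
# B3 — T. Bałaban, *(Higgs)₂,₃ quantum fields in a finite volume. III. Renormalization*, CMP **88** (1983) 411–445
[Balaban1983Higgs3] — p. 422 [PDF 12] (2.1), p. 423 [PDF 13] (2.2) and p. 416 [PDF 6] (1.21): the DEGREE OF A GLUED GRAPH on the
concrete graph model `B3Cor23Concrete.Graph` (p18) — how the vertex degrees D_G(v) (2.1) and the graph degree D(G) (2.2) change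
when two graphs of the model are joined by one new internal line (`B3GraphGlue.glue`): only the two vertices carrying the glued
legs change, each by (2 − d)/2 for the newly internal leg, by +1 more if that leg is an A′-leg of an averaging vertex
(1.13)–(1.15), and by −(number of differentiations) if it is the differentiated φ′-leg of (1.8)/(1.9); hence
**D(glue) = D(G₁) + D(G₂) + 2 + (averaging gains) − (differentiation gains)**, = D(G₁) + D(G₂) + 2 for two undifferentiated
φ′-legs (the C₀^ε-lines of the chains (1.21))

statement-level skeleton of published theorems with citation tags; proofs where landed; nothing here is a claim about
the Yang–Mills mass gap

PDF held: `paper:balaban1983-higgs-2-3-quantum-fields-finite-volume` (journal page = PDF page + 410); pp. 416, 422–423 read in the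
text layer (`p0006.txt`, `p0012.txt`, `p0013.txt` of `lit read`) and on the ×2 renders `run/shared/lean/pub/pub-balaban/
b2b-balaban-ref1/pages/1983-cmp88-higgs23-III/1983-cmp88-higgs23-III-p006, p012, p013-x2.png`.

CITATION HEADER (lean-in-tree rule).  lit-balaban TYPED SKELETON (HOME `run/shared/lean/pub/lit-balaban/`), PHASE 2, seat p37
gen 106 (unit `lit-balaban-p37`; TAKING lines HOME/STATUS.md 2026-08-23, FILE G of BRICK 3), for rows **B3.Eq1.19-1.22** and
**B3.Eq2.1** / **B3.Eq2.2-2.3** of `HOME/lit-balaban-r15/ROWS-B3.md` as a located member (fold owner r15, referee ref-4; lead g12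
HEAD WORD Q25 2026-08-23T08:24:18Z: bricks WELCOME as located members, zero head weight).  Siblings (same seat): `B3GraphGlueLegs`,
`B3GraphGlue` (`glue`; imported), `B3OnePIChainGlue` (chains), `B3OnePIChainDegree` (the chain version of this file).  REUSED BY NAME, nothing re-declared: p18's `B3Cor23Concrete.Graph` with its
degree data `intScalar`/`intVector`/`intDiffs` ((2.1) incidence), `vertexDeg` ((2.1)), `deg` ((2.2)) and the unfoldings
`vertexDeg_eq`, `deg_eq`; `B3GraphGlueLegs.legL`/`legR`/`glueOther_legL_self`/`_of_ne`/….

KIND «(ours)» (G.5-54): the bookkeeping below is OURS — (2.1)/(2.2) evaluated on our glue constructor; print provenance is claimed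
only for the quoted definitions; each declaration's cite tag locates the printed notion it serves.

THE PRINTED TEXT (verbatim).  p. 422 (2.1): *"D_G(v) = (the number of factors η in v) + (the number of legs of scalar or vector
fields in v belonging to internal lines of the graph G)·(−d+2)/2 − (the number of differentiations in v acting on internal lines
of the graph G) + [the number of legs of vector fields in v belonging to internal lines of the graph G in the case when v is a
vertex of the form (1.14) and (1.15)]."*  p. 423 (2.2): *"D(G) = Σ_{v∈G} D_G(v) − d."*  p. 416 (1.21): *"G^ε = Σ_{n=0}^∞ C₀^ε[(−δm² +
Σ^ε + ∂^{ε*}Σ₁^ε + Σ₁^{ε*}∂^ε + ∂^{ε*}Σ₂^ε∂^ε)C₀^ε]ⁿ"* (the Σ₁, Σ₂ insertions are the ones whose differentiated leg is external and,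
in a chain, comes to act on the joining C₀^ε-line).

WHAT IS TYPED / PROVED (four bookkeeping `def`s with bodies + kernel theorems; no `Prop` fact, no `sorry`; standard axioms).
§1 `card_filter_fin_congr` (re-indexing a count along an equality of naturals); the GAINS of a leg `a` of `G` at a vertex `i` when
`a` becomes internal: `legCountS G a i`/`legCountV G a i` (1 if `a` is a φ′-leg, resp. an A′-leg, of `i`, else 0; written as filter counts),
**`diffGain G a i`** (the differentiations of `i` if `a` is its first φ′-leg, else 0), **`avgGain G a i`** (1 if `i` is an averaging
vertex and `a` one of its A′-legs); `sum_legCount` (over all vertices the leg counts of `a` sum to 1), `sum_diffGain`, `sum_avgGain`.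
§2 INCIDENCE OF THE GLUED GRAPH: `intScalar_glue_castAdd`/`_natAdd`, `intVector_glue_castAdd`/`_natAdd`, `intDiffs_glue_castAdd`/
`_natAdd` — at a vertex of the first (second) piece the glued graph has the old incidence plus the gains of `a` (`b`).
§3 **`vertexDeg_glue_castAdd`/`vertexDeg_glue_natAdd`** ((2.1) of the glued graph vertex by vertex) and
**`deg_glue`**: `(glue G₁ G₂ a b …).deg d = G₁.deg d + G₂.deg d + 2 + (avgGain sums) − (diffGain sums)`; **`deg_glue_scalar`**: for
two φ′-legs `= G₁.deg d + G₂.deg d + 2 − diffGain G₁ a a.1 − diffGain G₂ b b.1`, and **`deg_glue_scalar_undiff`** `= G₁.deg d +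
G₂.deg d + 2` when neither glued leg is a differentiated first leg (`diffGain_eq_zero_of_ne`, `diffGain_eq_zero_of_diffCount`).
(The chain version `D(chain T l) = D(T) + Σ D(lᵢ) + 2·|l| − corrections` is the sibling `B3OnePIChainDegree`.)
HONEST SCOPE.  Bookkeeping identities on the model only; no statement about which degrees are positive (Cor. 2.3 is p18's
`B3Cor23ConcreteProof`), no counterterm degrees ((2.3)'s inductive clause: p18 takes mass renormalization vertices in the attached
form, `ctDeg = 0`), nothing analytic.
-/

namespace Literature.MathematicalPhysics.QuantumFieldTheory.Balaban1983to89.B3GraphGlueDegree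

open Finset B3Prop1 B3Cor23Concrete B3OnePIGraphs B3GraphGlueLegs B3GraphGlue

variable {nbar : ℕ}

/-! ## §1 Re-indexing; the gains of a leg that becomes internal -/

/-- kernel: a count over `Fin m'` re-indexed along `m = m'`. [cite: Balaban1983Higgs3, (2.1) p.422] -/
theorem card_filter_fin_congr {m m' : ℕ} (h : m = m') (P : Fin m' → Prop) [DecidablePred P] :
    (univ.filter P).card = (univ.filter fun j : Fin m => P (Fin.cast h j)).card := by
  subst h; rfl

section Gains

variable (G : Graph nbar) (a : Leg G.kind)

/-- `legCountS G a i`: the number of φ′-legs `j` of the vertex `i` with `⟨i, φ′_j⟩ = a` (1 if `a` is a φ′-leg of `i`, else 0).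
[cite: Balaban1983Higgs3, (2.1) p.422] -/
def legCountS (i : Fin G.nV) : ℕ :=
  (univ.filter fun j : Fin (G.kind i).scalarLegs => (⟨i, .inl j⟩ : Leg G.kind) = a).card

/-- `legCountV G a i`: the number of A′-legs `j` of the vertex `i` with `⟨i, A′_j⟩ = a` (1 if `a` is an A′-leg of `i`, else 0).
[cite: Balaban1983Higgs3, (2.1) p.422] -/
def legCountV (i : Fin G.nV) : ℕ :=
  (univ.filter fun j : Fin (G.kind i).vectorLegs => (⟨i, .inr j⟩ : Leg G.kind) = a).card

/-- `diffGain G a i`: the number of differentiations of the vertex `i` that come to act on an internal line when the leg `a`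
becomes internal — the differentiation D^η_B̃ of (1.8)/(1.9) acts on the first φ′-leg (p18's `intDiffs`), so this is
`(G.kind i).diffCount` if `a` is that leg, else 0. [cite: Balaban1983Higgs3, (2.1) p.422] -/
def diffGain (i : Fin G.nV) : ℕ :=
  if h : 0 < (G.kind i).scalarLegs then (if a = ⟨i, .inl ⟨0, h⟩⟩ then (G.kind i).diffCount else 0) else 0

/-- `avgGain G a i`: the bracket of (2.1) — 1 if `i` is a vertex of the form (1.13)–(1.15) and `a` is one of its A′-legs, else 0.
[cite: Balaban1983Higgs3, (2.1) p.422] -/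
def avgGain (i : Fin G.nV) : ℕ :=
  if (G.kind i).isAveragingVertex then legCountV G a i else 0

variable {G a}

/-- kernel: at a vertex other than that of `a`, `a` is not a φ′-leg. [cite: Balaban1983Higgs3, (2.1) p.422] -/
theorem legCountS_of_ne {i : Fin G.nV} (hi : i ≠ a.1) : legCountS G a i = 0 := by
  unfold legCountS
  rw [card_eq_zero, filter_eq_empty_iff]
  rintro j - hj
  exact hi (by rw [← hj])

/-- kernel: at a vertex other than that of `a`, `a` is not an A′-leg. [cite: Balaban1983Higgs3, (2.1) p.422] -/
theorem legCountV_of_ne {i : Fin G.nV} (hi : i ≠ a.1) : legCountV G a i = 0 := by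
  unfold legCountV
  rw [card_eq_zero, filter_eq_empty_iff]
  rintro j - hj
  exact hi (by rw [← hj])

/-- kernel: at its own vertex, `a` is one φ′-leg or one A′-leg: the two counts are (1, 0) or (0, 1).
[cite: Balaban1983Higgs3, (2.1) p.422] -/
theorem legCount_self :
    legCountS G a a.1 = (if a.2.isLeft then 1 else 0) ∧ legCountV G a a.1 = (if a.2.isLeft then 0 else 1) := by
  obtain ⟨i, s⟩ := a
  unfold legCountS legCountV
  cases s with
  | inl j₀ =>
      constructor
      · rw [show (univ.filter fun j : Fin (G.kind i).scalarLegs => (⟨i, .inl j⟩ : Leg G.kind) = ⟨i, .inl j₀⟩) = {j₀} from ?_]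
        · simp
        · ext j; simp
      · simp
  | inr j₀ =>
      constructor
      · simp
      · rw [show (univ.filter fun j : Fin (G.kind i).vectorLegs => (⟨i, .inr j⟩ : Leg G.kind) = ⟨i, .inr j₀⟩) = {j₀} from ?_]
        · simp
        · ext j; simp

/-- kernel: summed over all vertices, the leg counts of `a` total ONE (the leg `a` itself). [cite: Balaban1983Higgs3, (2.1) p.422] -/
theorem sum_legCount : ∑ i, (legCountS G a i + legCountV G a i) = 1 := by
  rw [Finset.sum_eq_single a.1]
  · obtain ⟨hS, hV⟩ := legCount_self (G := G) (a := a)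
    rw [hS, hV]; split_ifs <;> rfl
  · intro i _ hi; simp [legCountS_of_ne hi, legCountV_of_ne hi]
  · intro h; exact absurd (mem_univ _) h

/-- kernel: the differentiation gain lives at the vertex of `a` only. [cite: Balaban1983Higgs3, (2.1) p.422] -/
theorem diffGain_of_ne {i : Fin G.nV} (hi : i ≠ a.1) : diffGain G a i = 0 := by
  unfold diffGain
  split_ifs with h h'
  · exact absurd (by rw [h']) hi
  · rfl
  · rfl

/-- kernel: summed over all vertices, the differentiation gain is the one at the vertex of `a`. [cite: Balaban1983Higgs3, (2.1) p.422] -/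
theorem sum_diffGain : ∑ i, diffGain G a i = diffGain G a a.1 := by
  rw [Finset.sum_eq_single a.1]
  · intro i _ hi; exact diffGain_of_ne hi
  · intro h; exact absurd (mem_univ _) h

/-- kernel: the averaging gain lives at the vertex of `a` only. [cite: Balaban1983Higgs3, (2.1) p.422] -/
theorem avgGain_of_ne {i : Fin G.nV} (hi : i ≠ a.1) : avgGain G a i = 0 := by
  unfold avgGain; rw [legCountV_of_ne hi]; split_ifs <;> rfl

/-- kernel: summed over all vertices, the averaging gain is the one at the vertex of `a`; it is 1 iff that vertex is of the
form (1.13)–(1.15) and `a` is an A′-leg, else 0. [cite: Balaban1983Higgs3, (2.1) p.422] -/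
theorem sum_avgGain : ∑ i, avgGain G a i = avgGain G a a.1 := by
  rw [Finset.sum_eq_single a.1]
  · intro i _ hi; exact avgGain_of_ne hi
  · intro h; exact absurd (mem_univ _) h

/-- kernel: the averaging gain vanishes for a φ′-leg. [cite: Balaban1983Higgs3, (2.1) p.422] -/
theorem avgGain_eq_zero_of_isLeft (ha' : a.2.isLeft = true) (i : Fin G.nV) : avgGain G a i = 0 := by
  by_cases hi : i = a.1
  · subst hi
    unfold avgGain
    rw [(legCount_self (G := G) (a := a)).2]
    simp [ha']
  · exact avgGain_of_ne hi

/-- kernel: the averaging gain is at most 1. [cite: Balaban1983Higgs3, (2.1) p.422] -/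
theorem avgGain_le_one (i : Fin G.nV) : avgGain G a i ≤ 1 := by
  by_cases hi : i = a.1
  · subst hi
    unfold avgGain
    rw [(legCount_self (G := G) (a := a)).2]
    split_ifs <;> simp
  · rw [avgGain_of_ne hi]; exact Nat.zero_le _

/-- kernel: a count of the legs `f j` that are "`a` or internal" splits into the internal ones plus the ones equal to `a`, since `a`
is external. [cite: Balaban1983Higgs3, (2.1) p.422] -/
theorem card_filter_eq_or_isSome (ha : G.other a = none) {ι : Type*} [DecidableEq ι] (s : Finset ι) (f : ι → Leg G.kind) :
    (s.filter fun j => f j = a ∨ (G.other (f j)).isSome).card =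
      (s.filter fun j => (G.other (f j)).isSome).card + (s.filter fun j => f j = a).card := by
  rw [← card_union_of_disjoint]
  · congr 1; ext j
    simp only [mem_filter, mem_union]
    tauto
  · rw [disjoint_left]
    intro j hj hj'
    simp only [mem_filter] at hj hj'
    rw [hj'.2, ha] at hj
    simp at hj

end Gains

/-! ## §2 Incidence of the glued graph -/

section Incidence

variable {G₁ G₂ : Graph nbar} {a : Leg G₁.kind} {b : Leg G₂.kind} {ha : G₁.other a = none} {hb : G₂.other b = none}
  {hab : a.2.isLeft = b.2.isLeft}

omit hab in
/-- kernel: whether an embedded leg of the first piece lies on an internal line of the glued line data — yes if it is `a` (the new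
line), otherwise as in `G₁`. [cite: Balaban1983Higgs3, (1.21) p.416] -/
theorem isSome_glueOther_legL (x : Leg G₁.kind) :
    (glueOther G₁.other G₂.other a b (legL G₁.kind G₂.kind x)).isSome ↔ x = a ∨ (G₁.other x).isSome := by
  by_cases hx : x = a
  · subst hx; simp
  · rw [glueOther_legL_of_ne hx, Option.isSome_map]; simp [hx]

omit hab in
/-- kernel: the same for an embedded leg of the second piece. [cite: Balaban1983Higgs3, (1.21) p.416] -/
theorem isSome_glueOther_legR (y : Leg G₂.kind) :
    (glueOther G₁.other G₂.other a b (legR G₁.kind G₂.kind y)).isSome ↔ y = b ∨ (G₂.other y).isSome := by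
  by_cases hy : y = b
  · subst hy; simp
  · rw [glueOther_legR_of_ne hy, Option.isSome_map]; simp [hy]

/-- **internal φ′-legs at a vertex of the first piece**: the old ones, plus one if `a` is a φ′-leg of that vertex.
[cite: Balaban1983Higgs3, (2.1) p.422] -/
theorem intScalar_glue_castAdd (i : Fin G₁.nV) :
    (glue G₁ G₂ a b ha hb hab).intScalar (Fin.castAdd G₂.nV i) = G₁.intScalar i + legCountS G₁ a i := by
  unfold Graph.intScalar legCountS
  rw [card_filter_fin_congr (congrArg VertexKind.scalarLegs (Fin.append_left G₁.kind G₂.kind i).symm),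
    ← card_filter_eq_or_isSome ha]
  congr 1; ext j
  simp only [mem_filter, mem_univ, true_and]
  change (glueOther G₁.other G₂.other a b (legL G₁.kind G₂.kind ⟨i, .inl j⟩)).isSome = true ↔ _
  rw [isSome_glueOther_legL]

/-- **internal A′-legs at a vertex of the first piece**: the old ones, plus one if `a` is an A′-leg of that vertex.
[cite: Balaban1983Higgs3, (2.1) p.422] -/
theorem intVector_glue_castAdd (i : Fin G₁.nV) :
    (glue G₁ G₂ a b ha hb hab).intVector (Fin.castAdd G₂.nV i) = G₁.intVector i + legCountV G₁ a i := by
  unfold Graph.intVector legCountV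
  rw [card_filter_fin_congr (congrArg VertexKind.vectorLegs (Fin.append_left G₁.kind G₂.kind i).symm),
    ← card_filter_eq_or_isSome ha]
  congr 1; ext j
  simp only [mem_filter, mem_univ, true_and]
  change (glueOther G₁.other G₂.other a b (legL G₁.kind G₂.kind ⟨i, .inr j⟩)).isSome = true ↔ _
  rw [isSome_glueOther_legL]

/-- **internal φ′-legs at a vertex of the second piece**. [cite: Balaban1983Higgs3, (2.1) p.422] -/
theorem intScalar_glue_natAdd (i : Fin G₂.nV) :
    (glue G₁ G₂ a b ha hb hab).intScalar (Fin.natAdd G₁.nV i) = G₂.intScalar i + legCountS G₂ b i := by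
  unfold Graph.intScalar legCountS
  rw [card_filter_fin_congr (congrArg VertexKind.scalarLegs (Fin.append_right G₁.kind G₂.kind i).symm),
    ← card_filter_eq_or_isSome hb]
  congr 1; ext j
  simp only [mem_filter, mem_univ, true_and]
  change (glueOther G₁.other G₂.other a b (legR G₁.kind G₂.kind ⟨i, .inl j⟩)).isSome = true ↔ _
  rw [isSome_glueOther_legR]

/-- **internal A′-legs at a vertex of the second piece**. [cite: Balaban1983Higgs3, (2.1) p.422] -/
theorem intVector_glue_natAdd (i : Fin G₂.nV) :
    (glue G₁ G₂ a b ha hb hab).intVector (Fin.natAdd G₁.nV i) = G₂.intVector i + legCountV G₂ b i := by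
  unfold Graph.intVector legCountV
  rw [card_filter_fin_congr (congrArg VertexKind.vectorLegs (Fin.append_right G₁.kind G₂.kind i).symm),
    ← card_filter_eq_or_isSome hb]
  congr 1; ext j
  simp only [mem_filter, mem_univ, true_and]
  change (glueOther G₁.other G₂.other a b (legR G₁.kind G₂.kind ⟨i, .inr j⟩)).isSome = true ↔ _
  rw [isSome_glueOther_legR]

omit hab in
/-- kernel: p18's `intDiffs` expression as a function of the vertex kind and of the "is internal" profile of its φ′-legs,
re-indexed along an equality of kinds. [cite: Balaban1983Higgs3, (2.1) p.422] -/
theorem intDiffsAux_congr {v w : VertexKind} (h : v = w) (f : Fin v.scalarLegs → Bool) (g : Fin w.scalarLegs → Bool)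
    (hfg : ∀ j, f j = g (Fin.cast (congrArg VertexKind.scalarLegs h) j)) :
    (if hv : 0 < v.scalarLegs then (if f ⟨0, hv⟩ then v.diffCount else 0) else 0) =
      (if hw : 0 < w.scalarLegs then (if g ⟨0, hw⟩ then w.diffCount else 0) else 0) := by
  subst h
  have : f = g := funext fun j => by simpa using hfg j
  subst this
  rfl

/-- kernel: the value of p18's `intDiffs` expression on the first piece's data, with the leg `a` counted as internal, is the old
value plus `diffGain`. [cite: Balaban1983Higgs3, (2.1) p.422] -/
theorem intDiffsAux_eq (G : Graph nbar) (a : Leg G.kind) (ha : G.other a = none) (i : Fin G.nV) (g : Fin (G.kind i).scalarLegs → Bool)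
    (hg : ∀ j, g j = true ↔ (⟨i, .inl j⟩ : Leg G.kind) = a ∨ (G.other ⟨i, .inl j⟩).isSome) :
    (if hw : 0 < (G.kind i).scalarLegs then (if g ⟨0, hw⟩ then (G.kind i).diffCount else 0) else 0) =
      G.intDiffs i + diffGain G a i := by
  unfold Graph.intDiffs diffGain
  by_cases hw : 0 < (G.kind i).scalarLegs
  · simp only [hw, dite_true]
    by_cases h0 : (⟨i, .inl ⟨0, hw⟩⟩ : Leg G.kind) = a
    · have hnone : G.other ⟨i, .inl ⟨0, hw⟩⟩ = none := by rw [h0, ha]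
      have hg0 : g ⟨0, hw⟩ = true := (hg _).2 (Or.inl h0)
      simp [hg0, hnone, h0.symm]
    · have h0' : ¬ a = ⟨i, .inl ⟨0, hw⟩⟩ := fun h => h0 h.symm
      by_cases hs : (G.other ⟨i, .inl ⟨0, hw⟩⟩).isSome
      · have hg0 : g ⟨0, hw⟩ = true := (hg _).2 (Or.inr hs)
        simp [hg0, hs, h0']
      · have hg0 : ¬ g ⟨0, hw⟩ = true := fun h => by
          rcases (hg _).1 h with h | h
          · exact h0 h
          · exact hs h
        simp [hg0, hs, h0']
  · simp [hw]

/-- **differentiations acting on internal lines at a vertex of the first piece**: the old ones, plus `diffGain G₁ a i`.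
[cite: Balaban1983Higgs3, (2.1) p.422] -/
theorem intDiffs_glue_castAdd (i : Fin G₁.nV) :
    (glue G₁ G₂ a b ha hb hab).intDiffs (Fin.castAdd G₂.nV i) = G₁.intDiffs i + diffGain G₁ a i := by
  refine (intDiffsAux_congr (Fin.append_left G₁.kind G₂.kind i)
    (fun j => ((glue G₁ G₂ a b ha hb hab).other ⟨Fin.castAdd G₂.nV i, .inl j⟩).isSome)
    (fun j => (glueOther G₁.other G₂.other a b (legL G₁.kind G₂.kind ⟨i, .inl j⟩)).isSome) (fun _ => rfl)).trans ?_
  exact intDiffsAux_eq G₁ a ha i _ (fun j => isSome_glueOther_legL (b := b) ⟨i, .inl j⟩)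

/-- **differentiations acting on internal lines at a vertex of the second piece**. [cite: Balaban1983Higgs3, (2.1) p.422] -/
theorem intDiffs_glue_natAdd (i : Fin G₂.nV) :
    (glue G₁ G₂ a b ha hb hab).intDiffs (Fin.natAdd G₁.nV i) = G₂.intDiffs i + diffGain G₂ b i := by
  refine (intDiffsAux_congr (Fin.append_right G₁.kind G₂.kind i)
    (fun j => ((glue G₁ G₂ a b ha hb hab).other ⟨Fin.natAdd G₁.nV i, .inl j⟩).isSome)
    (fun j => (glueOther G₁.other G₂.other a b (legR G₁.kind G₂.kind ⟨i, .inl j⟩)).isSome) (fun _ => rfl)).trans ?_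
  exact intDiffsAux_eq G₂ b hb i _ (fun j => isSome_glueOther_legR (a := a) ⟨i, .inl j⟩)

end Incidence

/-! ## §3 Vertex degrees (2.1) and the degree (2.2) of the glued graph -/

section Degree

variable {G₁ G₂ : Graph nbar} {a : Leg G₁.kind} {b : Leg G₂.kind} {ha : G₁.other a = none} {hb : G₂.other b = none}
  {hab : a.2.isLeft = b.2.isLeft}

/-- **(2.1) at a vertex of the first piece**: the glued graph's vertex degree is the old one, plus (2 − d)/2 for the leg `a` if it
sits at this vertex, minus the differentiation gain, plus the averaging gain. [cite: Balaban1983Higgs3, (2.1) p.422] -/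
theorem vertexDeg_glue_castAdd (d : ℕ) (i : Fin G₁.nV) :
    (glue G₁ G₂ a b ha hb hab).vertexDeg d (Fin.castAdd G₂.nV i) =
      G₁.vertexDeg d i + ((legCountS G₁ a i + legCountV G₁ a i : ℕ) : ℚ) * ((2 - (d : ℚ)) / 2)
        - (diffGain G₁ a i : ℚ) + (avgGain G₁ a i : ℚ) := by
  rw [Graph.vertexDeg_eq, Graph.vertexDeg_eq, intScalar_glue_castAdd, intVector_glue_castAdd, intDiffs_glue_castAdd]
  have hk : (glue G₁ G₂ a b ha hb hab).kind (Fin.castAdd G₂.nV i) = G₁.kind i := Fin.append_left _ _ _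
  rw [hk]
  unfold avgGain
  split_ifs <;> (push_cast; ring)

/-- **(2.1) at a vertex of the second piece**. [cite: Balaban1983Higgs3, (2.1) p.422] -/
theorem vertexDeg_glue_natAdd (d : ℕ) (i : Fin G₂.nV) :
    (glue G₁ G₂ a b ha hb hab).vertexDeg d (Fin.natAdd G₁.nV i) =
      G₂.vertexDeg d i + ((legCountS G₂ b i + legCountV G₂ b i : ℕ) : ℚ) * ((2 - (d : ℚ)) / 2)
        - (diffGain G₂ b i : ℚ) + (avgGain G₂ b i : ℚ) := by
  rw [Graph.vertexDeg_eq, Graph.vertexDeg_eq, intScalar_glue_natAdd, intVector_glue_natAdd, intDiffs_glue_natAdd]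
  have hk : (glue G₁ G₂ a b ha hb hab).kind (Fin.natAdd G₁.nV i) = G₂.kind i := Fin.append_right _ _ _
  rw [hk]
  unfold avgGain
  split_ifs <;> (push_cast; ring)

/-- **(2.2) OF THE GLUED GRAPH**: `D(glue) = D(G₁) + D(G₂) + 2 + (averaging gains) − (differentiation gains)` — the two newly
internal legs contribute 2·(2 − d)/2, and the second piece's "− d" is no longer subtracted separately (one graph, one "− d"):
(d) + (2 − d) = 2. [cite: Balaban1983Higgs3, (2.2) p.423] -/
theorem deg_glue (d : ℕ) :
    (glue G₁ G₂ a b ha hb hab).deg d =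
      G₁.deg d + G₂.deg d + 2 + ((avgGain G₁ a a.1 + avgGain G₂ b b.1 : ℕ) : ℚ)
        - ((diffGain G₁ a a.1 + diffGain G₂ b b.1 : ℕ) : ℚ) := by
  rw [Graph.deg_eq, Graph.deg_eq, Graph.deg_eq]
  rw [show (∑ v, (glue G₁ G₂ a b ha hb hab).vertexDeg d v) =
      (∑ i : Fin G₁.nV, (glue G₁ G₂ a b ha hb hab).vertexDeg d (Fin.castAdd G₂.nV i)) +
        ∑ j : Fin G₂.nV, (glue G₁ G₂ a b ha hb hab).vertexDeg d (Fin.natAdd G₁.nV j) from Fin.sum_univ_add _]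
  simp only [vertexDeg_glue_castAdd, vertexDeg_glue_natAdd, Finset.sum_add_distrib, Finset.sum_sub_distrib,
    ← Finset.sum_mul]
  have h₁ := sum_legCount (G := G₁) (a := a)
  have h₂ := sum_legCount (G := G₂) (a := b)
  have h₃ := sum_diffGain (G := G₁) (a := a)
  have h₄ := sum_diffGain (G := G₂) (a := b)
  have h₅ := sum_avgGain (G := G₁) (a := a)
  have h₆ := sum_avgGain (G := G₂) (a := b)
  have e₁ : (∑ i, ((legCountS G₁ a i + legCountV G₁ a i : ℕ) : ℚ)) = 1 := by exact_mod_cast h₁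
  have e₂ : (∑ i, ((legCountS G₂ b i + legCountV G₂ b i : ℕ) : ℚ)) = 1 := by exact_mod_cast h₂
  have e₃ : (∑ i, (diffGain G₁ a i : ℚ)) = diffGain G₁ a a.1 := by exact_mod_cast h₃
  have e₄ : (∑ i, (diffGain G₂ b i : ℚ)) = diffGain G₂ b b.1 := by exact_mod_cast h₄
  have e₅ : (∑ i, (avgGain G₁ a i : ℚ)) = avgGain G₁ a a.1 := by exact_mod_cast h₅
  have e₆ : (∑ i, (avgGain G₂ b i : ℚ)) = avgGain G₂ b b.1 := by exact_mod_cast h₆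
  rw [e₁, e₂, e₃, e₄, e₅, e₆]
  push_cast
  ring

/-- **two φ′-legs** (the case of (1.21): the joining line is a scalar propagator C₀^ε): no averaging gain, so
`D(glue) = D(G₁) + D(G₂) + 2 − diffGain₁ − diffGain₂`. [cite: Balaban1983Higgs3, (1.21) p.416] -/
theorem deg_glue_scalar (d : ℕ) (ha' : a.2.isLeft = true) :
    (glue G₁ G₂ a b ha hb hab).deg d =
      G₁.deg d + G₂.deg d + 2 - ((diffGain G₁ a a.1 + diffGain G₂ b b.1 : ℕ) : ℚ) := by
  have hb' : b.2.isLeft = true := hab ▸ ha'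
  rw [deg_glue, avgGain_eq_zero_of_isLeft ha', avgGain_eq_zero_of_isLeft hb']
  push_cast
  ring

/-- kernel: the differentiation gain vanishes unless `a` is the first φ′-leg of its vertex. [cite: Balaban1983Higgs3, (2.1) p.422] -/
theorem diffGain_eq_zero_of_ne (h : ∀ hs : 0 < (G₁.kind a.1).scalarLegs, a ≠ ⟨a.1, .inl ⟨0, hs⟩⟩) : diffGain G₁ a a.1 = 0 := by
  unfold diffGain
  split_ifs with hs h'
  · exact absurd h' (h hs)
  · rfl
  · rfl

/-- kernel: the differentiation gain vanishes at a vertex without differentiations (e.g. (1.6), (1.7), (1.10)–(1.15)).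
[cite: Balaban1983Higgs3, (2.1) p.422] -/
theorem diffGain_eq_zero_of_diffCount (h : (G₁.kind a.1).diffCount = 0) : diffGain G₁ a a.1 = 0 := by
  unfold diffGain
  split_ifs <;> simp [h]

/-- **two undifferentiated φ′-legs**: `D(glue) = D(G₁) + D(G₂) + 2` — e.g. gluing two insertions of (1.21) whose joined legs
carry no differentiation (the Σ^ε-type pieces; for Σ₁^ε, Σ₂^ε the derivative on the joining line lowers this by 1 each).
[cite: Balaban1983Higgs3, (1.21) p.416] -/
theorem deg_glue_scalar_undiff (d : ℕ) (ha' : a.2.isLeft = true) (hda : diffGain G₁ a a.1 = 0) (hdb : diffGain G₂ b b.1 = 0) :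
    (glue G₁ G₂ a b ha hb hab).deg d = G₁.deg d + G₂.deg d + 2 := by
  rw [deg_glue_scalar d ha', hda, hdb]
  push_cast
  ring

end Degree

end Literature.MathematicalPhysics.QuantumFieldTheory.Balaban1983to89.B3GraphGlueDegree
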